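import Mathlib
import Literature.Analysis.FunctionSpaces.UniformlyConvexLogSobolevDomain
import HarnessLib

/-!
# From the exponential entropy inequality to the Poincaré (variance) inequality

Route-independent helper for the crux stmt-QuantumFields-23103 `Theses.TransverseWardBL.ConvexPhaseCoexactBound`
(route `TransverseWardBL`, LINE g9-C of the ideator seat ym-idea-4; an abelian `U(1)` line onto the leaf
`Theorems.U1HelicityGapTorusD4` — nothing here bears on the Yang–Mills mass gap).

The tree PROVES the Bobkov–Ledoux / Bakry–Émery entropy inequality in exponential form on convex domains
(`Literature.Analysis.FunctionSpaces.bobkovLedoux2000_prop31_convexDomain_exp`: the schema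
`HasEntropyExpC1c ν C`, `Ent_ν(e^φ) ≤ (C/2) ∫ ‖Dφ‖² e^φ dν` for `φ ∈ C¹_c`).  This file extracts from that
schema, for ANY probability measure `ν` on `ℝⁿ`, the **Poincaré inequality**
`Var_ν(f) ≤ C ∫ ‖Df‖² dν` for `f ∈ C¹_c` (`variance_le_of_hasEntropyExpC1c`) — Bakry–Gentil–Ledoux,
*Analysis and Geometry of Markov Diffusion Operators* (2014), Prop. 5.1.3 (`LS(C) ⇒ P(C)`), Guionnet LNM 1957
Exercise 5.4 ("put `f = 1 + εg` and let `ε → 0`").  Proof: `ε ↦ Ent_ν(e^{εf}) − (C/2)∫‖D(εf)‖²e^{εf}dν` is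
`≤ 0` with value `0` at `ε = 0`; its second derivative at `0`, computed by differentiating under the integral
sign (`hasDerivAt_integral_mul_exp`), is `Var_ν(f) − C∫‖Df‖²dν`, and the second-derivative test at a local
maximum (`deriv2_nonpos_of_localMax`) concludes.
-/

noncomputable section

open MeasureTheory Filter Set
open scoped Topology BigOperators

namespace Summit.QuantumFields.YangMills.Theorems.TransverseWardBL

/-! ### Real analysis: second-derivative test at a local maximum (local hypotheses) -/

/-- If `f ≤ f 0` on `(-r, r)`, `f` has derivative `f₁` there, and `f₁` has derivative `L` at `0`, then
`L ≤ 0` (Fermat + mean value theorem). [folklore] -/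
theorem deriv2_nonpos_of_localMax {f f₁ : ℝ → ℝ} {L r : ℝ} (hr : 0 < r)
    (hmax : ∀ t ∈ Ioo (-r) r, f t ≤ f 0) (hf : ∀ t ∈ Ioo (-r) r, HasDerivAt f (f₁ t) t)
    (hf₁ : HasDerivAt f₁ L 0) : L ≤ 0 := by
  by_contra hL
  push Not at hL
  have hnhds : Ioo (-r) r ∈ 𝓝 (0 : ℝ) := Ioo_mem_nhds (by linarith) hr
  have hlm : IsLocalMax f 0 := by
    show ∀ᶠ t in 𝓝 (0 : ℝ), f t ≤ f 0
    exact Filter.mem_of_superset hnhds fun t ht => hmax t ht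
  have h0 : f₁ 0 = 0 := IsLocalMax.hasDerivAt_eq_zero hlm (hf 0 (by constructor <;> linarith))
  have hsl : Tendsto (slope f₁ 0) (𝓝[≠] 0) (𝓝 L) := hasDerivAt_iff_tendsto_slope.1 hf₁
  have hev : ∀ᶠ t in 𝓝[>] (0 : ℝ), 0 < f₁ t := by
    have h1 : ∀ᶠ t in 𝓝[≠] (0 : ℝ), 0 < slope f₁ 0 t := hsl.eventually (lt_mem_nhds hL)
    have h2 : ∀ᶠ t in 𝓝[>] (0 : ℝ), 0 < slope f₁ 0 t :=
      h1.filter_mono (nhdsWithin_mono _ fun x hx => ne_of_gt hx)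
    filter_upwards [h2, self_mem_nhdsWithin] with t ht ht0
    rw [slope_def_field, h0, sub_zero, sub_zero] at ht
    exact (div_pos_iff_of_pos_right ht0).1 ht
  obtain ⟨u, hu, hsub⟩ := mem_nhdsGT_iff_exists_Ioo_subset.1 hev
  have hu' : 0 < u := hu
  set b : ℝ := min (u / 2) (r / 2) with hb
  have hb0 : 0 < b := by positivity
  have hbu : b ≤ u / 2 := min_le_left _ _
  have hbr : b ≤ r / 2 := min_le_right _ _
  obtain ⟨c, hc, hc'⟩ := exists_hasDerivAt_eq_slope f f₁ hb0
    (fun x hx => (hf x ⟨by linarith [hx.1], by linarith [hx.2]⟩).continuousAt.continuousWithinAt)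
    (fun x hx => hf x ⟨by linarith [hx.1], by linarith [hx.2]⟩)
  have hc1 : 0 < c := hc.1
  have hc2 : c < b := hc.2
  have hpos : 0 < f₁ c := hsub ⟨hc1, by linarith⟩
  rw [hc', sub_zero] at hpos
  have hnum : 0 < f b - f 0 := (div_pos_iff_of_pos_right hb0).1 hpos
  linarith [hmax b ⟨by linarith, by linarith⟩]

/-! ### Differentiation under the integral sign: `∫ g e^{εf}` -/

section Param

variable {X : Type*} [TopologicalSpace X] [MeasurableSpace X] [OpensMeasurableSpace X]

/-- For bounded continuous `f, g` and a finite measure, `ε ↦ ∫ g e^{εf}` has derivative `∫ g f e^{εf}`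
at every `|ε| < 1` (dominated differentiation, bound `K M e^{M}`). [folklore] -/
theorem hasDerivAt_integral_mul_exp (ν : Measure X) [IsFiniteMeasure ν] {f g : X → ℝ}
    (hf : Continuous f) (hg : Continuous g) {M K : ℝ} (hfb : ∀ x, |f x| ≤ M) (hgb : ∀ x, |g x| ≤ K)
    {ε : ℝ} (hε : ε ∈ Ioo (-1 : ℝ) 1) :
    HasDerivAt (fun s => ∫ x, g x * Real.exp (s * f x) ∂ν)
      (∫ x, g x * f x * Real.exp (ε * f x) ∂ν) ε := by
  have hexpb : ∀ s ∈ Ioo (-1 : ℝ) 1, ∀ x, Real.exp (s * f x) ≤ Real.exp M := by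
    intro s hs x
    apply Real.exp_le_exp.2
    have h1 : s * f x ≤ |s * f x| := le_abs_self _
    have h2 : |s * f x| = |s| * |f x| := abs_mul _ _
    have h3 : |s| ≤ 1 := abs_le.2 ⟨by linarith [hs.1], by linarith [hs.2]⟩
    nlinarith [abs_nonneg s, abs_nonneg (f x), hfb x]
  have hcont : ∀ s, Continuous fun x => g x * Real.exp (s * f x) := fun s =>
    hg.mul (Real.continuous_exp.comp (continuous_const.mul hf))
  have hcont' : ∀ s, Continuous fun x => g x * f x * Real.exp (s * f x) := fun s =>
    (hg.mul hf).mul (Real.continuous_exp.comp (continuous_const.mul hf))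
  have key := hasDerivAt_integral_of_dominated_loc_of_deriv_le (μ := ν)
    (F := fun s x => g x * Real.exp (s * f x)) (F' := fun s x => g x * f x * Real.exp (s * f x))
    (x₀ := ε) (bound := fun _ => |K| * |M| * Real.exp M) (s := Ioo (-1 : ℝ) 1)
    (Ioo_mem_nhds hε.1 hε.2)
    (Filter.Eventually.of_forall fun s => (hcont s).aestronglyMeasurable)
    (Integrable.of_bound (hcont ε).aestronglyMeasurable (|K| * Real.exp M)
      (ae_of_all _ fun x => by
        rw [Real.norm_eq_abs, abs_mul, abs_of_pos (Real.exp_pos _)]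
        exact mul_le_mul ((hgb x).trans (le_abs_self K)) (hexpb ε hε x) (Real.exp_pos _).le
          (abs_nonneg _)))
    (hcont' ε).aestronglyMeasurable
    (ae_of_all _ fun x s hs => by
      rw [Real.norm_eq_abs, abs_mul, abs_mul, abs_of_pos (Real.exp_pos _)]
      exact mul_le_mul (mul_le_mul ((hgb x).trans (le_abs_self K)) ((hfb x).trans (le_abs_self M))
        (abs_nonneg _) (abs_nonneg _)) (hexpb s hs x) (Real.exp_pos _).le (by positivity))
    (integrable_const _)
    (ae_of_all _ fun x s _ => by
      have h0 : HasDerivAt (fun r : ℝ => r * f x) (f x) s := by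
        simpa using (hasDerivAt_id' s).mul_const (f x)
      have h1 := (h0.exp).const_mul (g x)
      refine h1.congr_deriv ?_
      ring)
  exact key.2

end Param

/-! ### The extraction `Ent(e^φ)`-schema ⇒ variance inequality -/

open Literature.Analysis.FunctionSpaces in
/-- **Exponential entropy inequality ⇒ Poincaré inequality** (Bakry–Gentil–Ledoux Prop. 5.1.3 /
Guionnet Exercise 5.4, for the schema `HasEntropyExpC1c`): for a probability measure `ν` on `ℝⁿ` with
`Ent_ν(e^φ) ≤ (C/2)∫‖Dφ‖²e^φ dν` for all `φ ∈ C¹_c` (`C ≥ 0`), every `f ∈ C¹_c` satisfies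
`∫ f² dν − (∫ f dν)² ≤ C ∫ ‖Df‖² dν`. [cite: BakryGentilLedoux2014, Prop. 5.1.3] -/
theorem variance_le_of_hasEntropyExpC1c {n : ℕ} {ν : Measure (EuclideanSpace ℝ (Fin n))}
    [IsProbabilityMeasure ν] {C : ℝ} (h : HasEntropyExpC1c ν C)
    {f : EuclideanSpace ℝ (Fin n) → ℝ} (hf : ContDiff ℝ 1 f) (hfs : HasCompactSupport f) :
    ∫ x, f x ^ 2 ∂ν - (∫ x, f x ∂ν) ^ 2 ≤ C * ∫ x, ‖fderiv ℝ f x‖ ^ 2 ∂ν := by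
  -- bounds
  obtain ⟨M, hM⟩ := hf.continuous.bounded_above_of_compact_support hfs
  have hM0 : 0 ≤ M := (norm_nonneg _).trans (hM 0)
  have hfc : Continuous f := hf.continuous
  have hDc : Continuous (fderiv ℝ f) := hf.continuous_fderiv one_ne_zero
  obtain ⟨L, hL⟩ := hDc.bounded_above_of_compact_support (hfs.fderiv (𝕜 := ℝ))
  have hfb : ∀ x, |f x| ≤ M := fun x => by simpa [Real.norm_eq_abs] using hM x
  have hgc : Continuous fun x => ‖fderiv ℝ f x‖ ^ 2 := hDc.norm.pow 2
  have hgb : ∀ x, |‖fderiv ℝ f x‖ ^ 2| ≤ L ^ 2 := fun x => by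
    rw [abs_of_nonneg (sq_nonneg _)]
    exact pow_le_pow_left₀ (norm_nonneg _) (hL x) 2
  -- the parametrised integrals
  set B : ℝ → ℝ := fun s => ∫ x, (1 : ℝ) * Real.exp (s * f x) ∂ν with hBdef
  set B₁ : ℝ → ℝ := fun s => ∫ x, 1 * f x * Real.exp (s * f x) ∂ν with hB₁def
  set B₂ : ℝ → ℝ := fun s => ∫ x, 1 * f x * f x * Real.exp (s * f x) ∂ν with hB₂def
  set B₃ : ℝ → ℝ := fun s => ∫ x, 1 * f x * f x * f x * Real.exp (s * f x) ∂ν with hB₃def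
  set E : ℝ → ℝ := fun s => ∫ x, ‖fderiv ℝ f x‖ ^ 2 * Real.exp (s * f x) ∂ν with hEdef
  set E₁ : ℝ → ℝ := fun s => ∫ x, ‖fderiv ℝ f x‖ ^ 2 * f x * Real.exp (s * f x) ∂ν with hE₁def
  set E₂ : ℝ → ℝ := fun s => ∫ x, ‖fderiv ℝ f x‖ ^ 2 * f x * f x * Real.exp (s * f x) ∂ν with hE₂def
  have h1b : ∀ x : EuclideanSpace ℝ (Fin n), |(1 : ℝ)| ≤ 1 := fun _ => by simp
  have hB : ∀ s ∈ Ioo (-1 : ℝ) 1, HasDerivAt B (B₁ s) s := fun s hs =>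
    hasDerivAt_integral_mul_exp ν (g := fun _ => (1 : ℝ)) hfc continuous_const hfb h1b hs
  have hg1c : Continuous fun x => (1 : ℝ) * f x := continuous_const.mul hfc
  have hg1b : ∀ x, |(1 : ℝ) * f x| ≤ 1 * M := fun x => by
    rw [abs_mul]; exact mul_le_mul (h1b x) (hfb x) (abs_nonneg _) zero_le_one
  have hB₁ : ∀ s ∈ Ioo (-1 : ℝ) 1, HasDerivAt B₁ (B₂ s) s := fun s hs =>
    hasDerivAt_integral_mul_exp ν (g := fun x => (1 : ℝ) * f x) hfc hg1c hfb hg1b hs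
  have hg2c : Continuous fun x => (1 : ℝ) * f x * f x := hg1c.mul hfc
  have hg2b : ∀ x, |(1 : ℝ) * f x * f x| ≤ 1 * M * M := fun x => by
    rw [abs_mul]; exact mul_le_mul (hg1b x) (hfb x) (abs_nonneg _) (by positivity)
  have hB₂ : ∀ s ∈ Ioo (-1 : ℝ) 1, HasDerivAt B₂ (B₃ s) s := fun s hs =>
    hasDerivAt_integral_mul_exp ν (g := fun x => (1 : ℝ) * f x * f x) hfc hg2c hfb hg2b hs
  have hE : ∀ s ∈ Ioo (-1 : ℝ) 1, HasDerivAt E (E₁ s) s := fun s hs =>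
    hasDerivAt_integral_mul_exp ν (g := fun x => ‖fderiv ℝ f x‖ ^ 2) hfc hgc hfb hgb hs
  have hg3c : Continuous fun x => ‖fderiv ℝ f x‖ ^ 2 * f x := hgc.mul hfc
  have hg3b : ∀ x, |‖fderiv ℝ f x‖ ^ 2 * f x| ≤ L ^ 2 * M := fun x => by
    rw [abs_mul]; exact mul_le_mul (hgb x) (hfb x) (abs_nonneg _) (sq_nonneg _)
  have hE₁ : ∀ s ∈ Ioo (-1 : ℝ) 1, HasDerivAt E₁ (E₂ s) s := fun s hs =>
    hasDerivAt_integral_mul_exp ν (g := fun x => ‖fderiv ℝ f x‖ ^ 2 * f x) hfc hg3c hfb hg3b hs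
  -- positivity of `B`
  have hBpos : ∀ s, 0 < B s := fun s => by
    simp only [hBdef, one_mul]
    exact integral_exp_pos (Integrable.of_bound
      ((Real.continuous_exp.comp (continuous_const.mul hfc)).aestronglyMeasurable)
      (Real.exp (|s| * M)) (ae_of_all _ fun x => by
        rw [Real.norm_eq_abs, abs_of_pos (Real.exp_pos _)]
        apply Real.exp_le_exp.2
        calc s * f x ≤ |s * f x| := le_abs_self _
          _ = |s| * |f x| := abs_mul _ _
          _ ≤ |s| * M := mul_le_mul_of_nonneg_left (hfb x) (abs_nonneg _)))
  have hB0 : B 0 = 1 := by simp [hBdef]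
  -- the entropy inequality along the ray `ε f`
  have hent : ∀ s : ℝ, s * B₁ s - B s * Real.log (B s) - C / 2 * (s * s * E s) ≤ 0 := by
    intro s
    have hφ : ContDiff ℝ 1 fun x => s * f x := contDiff_const.mul hf
    have hφs : HasCompactSupport fun x => s * f x := hfs.mul_left
    have key := h _ hφ hφs
    have e1 : ∫ x, s * f x * Real.exp (s * f x) ∂ν = s * B₁ s := by
      simp only [hB₁def, one_mul, ← integral_const_mul]
      refine integral_congr_ae (ae_of_all _ fun x => ?_)
      ring
    have e2 : ∫ x, ‖fderiv ℝ (fun x => s * f x) x‖ ^ 2 * Real.exp (s * f x) ∂ν = s * s * E s := by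
      simp only [hEdef, ← integral_const_mul]
      refine integral_congr_ae (ae_of_all _ fun x => ?_)
      have hd : fderiv ℝ (fun x => s * f x) x = s • fderiv ℝ f x :=
        fderiv_const_mul (hf.differentiable one_ne_zero x) s
      show ‖fderiv ℝ (fun x => s * f x) x‖ ^ 2 * Real.exp (s * f x) =
        s * s * (‖fderiv ℝ f x‖ ^ 2 * Real.exp (s * f x))
      rw [hd, norm_smul, Real.norm_eq_abs, mul_pow, sq_abs]
      ring
    have e3 : ∫ x, Real.exp (s * f x) ∂ν = B s := by simp [hBdef]
    rw [e1, e2, e3] at key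
    linarith
  -- first derivative
  set H : ℝ → ℝ := fun s => s * B₁ s - B s * Real.log (B s) - C / 2 * (s * s * E s) with hHdef
  set H₁ : ℝ → ℝ := fun s => (1 * B₁ s + s * B₂ s) -
    (B₁ s * Real.log (B s) + B s * (B₁ s / B s)) - C / 2 * ((1 * s + s * 1) * E s + s * s * E₁ s)
    with hH₁def
  have hH : ∀ s ∈ Ioo (-1 : ℝ) 1, HasDerivAt H (H₁ s) s := by
    intro s hs
    have h1 := (hasDerivAt_id' s).mul (hB₁ s hs)
    have h2 := (hB s hs).mul ((hB s hs).log (hBpos s).ne')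
    have h3 := (((hasDerivAt_id' s).mul (hasDerivAt_id' s)).mul (hE s hs)).const_mul (C / 2)
    exact (h1.sub h2).sub h3
  -- second derivative at `0`
  have hmem0 : (0 : ℝ) ∈ Ioo (-1 : ℝ) 1 := by constructor <;> norm_num
  have hH₁ : HasDerivAt H₁ (B₂ 0 - B₁ 0 ^ 2 - C * E 0) 0 := by
    have hb1 := hB₁ 0 hmem0
    have hb := hB 0 hmem0
    have hb2 := hB₂ 0 hmem0
    have he := hE 0 hmem0
    have he1 := hE₁ 0 hmem0
    have t1 : HasDerivAt (fun s => 1 * B₁ s + s * B₂ s) (1 * B₂ 0 + (1 * B₂ 0 + 0 * B₃ 0)) 0 :=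
      (hb1.const_mul 1).add ((hasDerivAt_id' 0).mul hb2)
    have t2 : HasDerivAt (fun s => B₁ s * Real.log (B s) + B s * (B₁ s / B s))
        (B₂ 0 * Real.log (B 0) + B₁ 0 * (B₁ 0 / B 0) +
          (B₁ 0 * (B₁ 0 / B 0) + B 0 * ((B₂ 0 * B 0 - B₁ 0 * B₁ 0) / B 0 ^ 2))) 0 :=
      (hb1.mul (hb.log (hBpos 0).ne')).add (hb.mul (hb1.div hb (hBpos 0).ne'))
    have t3 : HasDerivAt (fun s => (1 * s + s * 1) * E s + s * s * E₁ s)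
        (((1 : ℝ) * 1 + 1 * 1) * E 0 + (1 * 0 + 0 * 1) * E₁ 0 + ((1 * 0 + 0 * 1) * E₁ 0 + 0 * 0 * E₂ 0)) 0 := by
      have a := (((hasDerivAt_id' (0 : ℝ)).const_mul (1 : ℝ)).add
        ((hasDerivAt_id' (0 : ℝ)).mul_const (1 : ℝ))).mul he
      have b := ((hasDerivAt_id' (0 : ℝ)).mul (hasDerivAt_id' 0)).mul he1
      exact a.add b
    have t := (t1.sub t2).sub (t3.const_mul (C / 2))
    refine t.congr_deriv ?_
    rw [hB0, Real.log_one]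
    field_simp
    ring
  -- the second-derivative test
  have hle : B₂ 0 - B₁ 0 ^ 2 - C * E 0 ≤ 0 := by
    refine deriv2_nonpos_of_localMax (f := H) (f₁ := H₁) zero_lt_one (fun t _ => ?_) hH hH₁
    have h0 : H 0 = 0 := by simp [hHdef, hB0]
    rw [h0]
    exact hent t
  -- evaluate at `0`
  have e1 : B₂ 0 = ∫ x, f x ^ 2 ∂ν := by
    simp only [hB₂def, zero_mul, Real.exp_zero, mul_one, one_mul, sq]
  have e2 : B₁ 0 = ∫ x, f x ∂ν := by
    simp only [hB₁def, zero_mul, Real.exp_zero, mul_one, one_mul]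
  have e3 : E 0 = ∫ x, ‖fderiv ℝ f x‖ ^ 2 ∂ν := by
    simp only [hEdef, zero_mul, Real.exp_zero, mul_one]
  rw [e1, e2, e3] at hle
  linarith

end Summit.QuantumFields.YangMills.Theorems.TransverseWardBL

end
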